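/-
Origin: expansion seat `planner-pub-hodgecm-pv02-g2-0`, handover 2026-08-18T04:2xZ (`HOME/pub-hodgecm-pv02-g2/lean/Pv02g2/PerL34/CharSpans.lean`, md5 9c9ff4da, 187 lines);
landed by the gen-6 packager in gate run 22 as `HodgeCM/PerL34/CharSpans.lean` (import ^import Pv[0-9]+\.PerL34\.→import HodgeCM.PerL34. ×1).
-/
/-
Origin: HOME/pub-hodgecm-pv02-g2/lean/Pv02g2/PerL34/CharSpans.lean — session planner-pub-hodgecm-pv02-g2-0 (unit
pub-hodgecm-pv02-g2, DAG-NODE PROVER #02 gen 2; LEMMAS v4 §9 seam S2).  Intended final place: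
`HodgeCM/PerL34/CharSpans.lean`, after pv03's `HodgeCM/PerL34/BallSpans.lean` (HANDOVER v6 2026-08-18T04:12:44Z,
md5 1f1b8b8c; here `import Pv03.PerL34.BallSpans` — PACKAGER: rewrite this ONE import to the landed module name;
pv03's file itself imports `Pv03.PerL34.BallCocycle` and `Pv14.PerL34.P43FrameBall`, rewritten likewise) and the
LANDED `HodgeCM/PerL34/CharsAssembly.lean` (pv13, run 19), `HodgeCM/PerL34/Assembly.lean` (carver, run 18),
`HodgeCM/Proofs/LevelDirected.lean`.  KERNEL glue: nothing cited, nothing asserted, no new mathematics — one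
identification of index types (dictionary D1/D2) and its consequences by name.
-/
import Summits.HodgeConjecture.HodgeCM.PerL34.BallSpans
import Summits.HodgeConjecture.HodgeCM.PerL34.CharsAssembly
import Summits.HodgeConjecture.HodgeCM.PerL34.Assembly
import Summits.HodgeConjecture.HodgeCM.Proofs.LevelDirected

/-!
# Seam S2 — the allowedness input of node N33 is node N31, BY NAME

LEMMAS v4 §9, seam **S2** ("N33 ⇐ N31 allowedness inside S1 — CLOSABLE BY NAME today modulo S1's dictionary:
`F.allowedᵢ d` ↔ `(T.t12 V c).allowed χ` and `open_chars_of_cluster T h31 : T.Open_chars` (pv13, run 19).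
BRIDGE = the identification D₁/D₂ := the side's character sets `TorusData.X` (part of the S1 constructor)").

S1 is pv03's `BallSpans.lean`: `BallSpanModel U V` (pv02's function-model data over the ball model, with abstract
index types `X i` and an abstract predicate `allowed : (i : Fin 2) → X i → Prop`) and
`BallSpans.BallSpanStepsInput T`, whose per-context residual contains the clause `∀ i χ, M.allowed i χ` ("all data
allowed", node N31 = Lemma 4.2(b)).  Here, per good context `(V, c)` of the theta model `T`:

* **D1/D2, DEFINITIONAL (index types).**  The data of type `Ψ₁` (`i = 0`) and `Ψ₂` (`i = 1`) are indexed by the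
  character set of the side-(12) torus, `X i := (T.t12 V c).X` — PerL v5 l. 315–316: "`T := U(W_1) × U(W_2)` …
  put `χ_{12} := χ'_1 ⊠ χ'_2`"; `Prior/Perl34.lean` `TorusData.X` = "the set of continuous characters `χ` of the
  compact abelian `[T]` with archimedean type `χ_∞ = w`".  The datum `(i, χ)` is the `i`-th component
  `(W_{i+1}, μ_{i+1}, χ'_{i+1})` of the pair `χ = χ'_1 ⊠ χ'_2` (lines `W_i` and splitting characters `μ_i` FIXED,
  Def 3.2 ll. 277–278); its slice `Θ_i(χ)[𝔭₊]` (`ThetaP i χ`) is the instantiator's, as in pv02/pv03.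
* **"allowed", DEFINITIONAL.**  `allowed i χ := (T.t12 V c).allowed χ` — `TorusData.allowed` = "`χ` arises from an
  allowed pair of type (12)" (Def 3.2 ll. 276–277: "An allowed pair of type (12) is a pair of allowed data of types
  `Ψ_1, Ψ_2` with `μ_1 μ_2 = μ_W`"), which contains "the component `(W_i, μ_i, χ'_i)` is an allowed datum of type
  `Ψ_i`" (ll. 272–276) — exactly the allowedness Prop 4.3 (l. 639: "There are allowed data of types `Ψ_1, Ψ_2` …")
  and the dictionary Props `Dict_thetaClass₀/₁` of `WedgeToClasses` speak about.
* **Consequence (KERNEL, by name).**  The clause `∀ i χ, M.allowed i χ` of `BallSpanStepsInput T` IS the side-(12)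
  half of the realisation input `T.Open_chars` (= the carver's `N31_chars T`, Lemma 4.2(b) ll. 529–532 typed), hence
  follows from pv13's `open_chars_of_cluster (h31 : ClusterOutputs T)` (`CharsAssembly`, run 19):
  `CharSpanStepsInput T` (pv03's residual MINUS the allowed clause) + `T.Open_chars` ⟹ `BallSpanStepsInput T`
  (`ballSpanStepsInput_of_chars`) ⟹ `T.Open_thetaWedge` (`open_thetaWedge_of_charSpans`, `open_thetaWedge_of_cluster`);
  and in the N34 assembly the SAME leaf `h31 : ClusterOutputs T` now feeds both node N31 and node N33
  (`perL_of_nodes_charSpans`).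

Net for the FRONTIER (LEMMAS §8 (iv) / F10) on the pv03 ball route: the per-context residual of N33 is
`CharLineSpans.Inputs` = {pv02's five INPUT Props of `LineSpanData.N33c_of` (`LeftInvariant`, `CompactInvariant`,
`FiniteStable` — N09–N10; `UHolomorphic` — N33b; `SomeNonzero` — N30 + N33a), `HolFromBall` (DEFINITIONAL D2/D6),
`Dense Δ` (PRINT: real approximation, Sansuc Cor. 3.5(iii) / Platonov–Rapinchuk Thm 7.7 / Borovoi 0804.4767
Cor. 3.13), `Dict_thetaClass₀/₁` (DEFINITIONAL D2), `Dict_cupWedge` (PRINT Voisin I 7.5/7.6/6.15)}; allowedness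
(N31) is no longer a separate leaf of N33.
-/

set_option autoImplicit false

noncomputable section

namespace HodgeCM
namespace PerL34
namespace CharSpans

open HodgeCM.PerL34.BallModel HodgeCM.PerL34.WedgeNonvanishing HodgeCM.PerL34.WedgeToClasses
  HodgeCM.PerL34.BallGlue HodgeCM.PerL34.BallSpans

variable {U : Universe} (T : U.ThetaModel)

/-- **pv02's function-model data over the ball model, per good context `(V, c)`, with the index types of the data of
types `Ψ₁, Ψ₂` FIXED to the side-(12) character set `(T.t12 V c).X`** (D1/D2): the compact factors `G_c`, the
finite-adelic group `G_f`, the image `Γ` of `G_U(L₀)`, the slices `Θ_i(χ)[𝔭₊]` of `ℂ²`-valued theta functions of the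
`i`-th component datum of the pair `χ`, `Hol`, and the level / class maps of the forms dictionary (pv03
`BallSpanModel`).  No `allowed` field: allowedness is `(T.t12 V c).allowed` (see `toBallSpanModel`). -/
structure CharLineSpans {L : CMField} {ι₁ : L →+* ℂ} (V : HermSpace3 L ι₁) (c : SeesawCtx L) where
  /-- the compact factors `∏_{b ≠ ι₁} U(3)` -/
  Gc : Type
  /-- `G_U(𝔸_f)` -/
  Gf : Type
  [iGc : Group Gc]
  [iGf : Group Gf]
  /-- the image of `G_U(L₀)` in `U(2,1) × G_c × G_f` -/
  Γ : Subgroup (U21 × Gc × Gf)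
  /-- `Θ_i(χ'_{i+1})[𝔭₊]` for the `i`-th component `χ'_{i+1}` of the pair `χ = χ'_1 ⊠ χ'_2 ∈ X([T])`, as `ℂ²`-valued
  functions on `U(2,1) × G_c × G_f` -/
  ThetaP : (i : Fin 2) → (T.t12 V c).X → Submodule ℂ (U21 × Gc × Gf → (Fin 2 → ℂ))
  /-- holomorphic one-forms on `𝔹²` as `ℂ²`-valued functions on `U(2,1)` -/
  Hol : Submodule ℂ (U21 → (Fin 2 → ℂ))
  /-- a torsion-free level of the form -/
  lvl : (Ball → (Fin 2 → ℂ)) → Level V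
  /-- the de Rham class on `P_Γ` of a form descending to `Γ` -/
  cls : (Γ : Level V) → (Ball → (Fin 2 → ℂ)) → U.CohC (U.pms L ι₁ V Γ) 1

attribute [instance] CharLineSpans.iGc CharLineSpans.iGf

namespace CharLineSpans

variable {T}
variable {L : CMField} {ι₁ : L →+* ℂ} {V : HermSpace3 L ι₁} {c : SeesawCtx L} (M : CharLineSpans T V c)

/-- **The S1 ∘ S2 constructor**: pv03's `BallSpanModel` with `X i := (T.t12 V c).X` and
`allowed i χ := (T.t12 V c).allowed χ` (both DEFINITIONAL, D1/D2). -/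
def toBallSpanModel : BallSpanModel U V where
  Gc := M.Gc
  Gf := M.Gf
  Γ := M.Γ
  X := fun _ => (T.t12 V c).X
  ThetaP := M.ThetaP
  Hol := M.Hol
  allowed := fun _ χ => (T.t12 V c).allowed χ
  lvl := M.lvl
  cls := M.cls

/-- The allowedness predicate of the constructed model IS the side-(12) `TorusData.allowed` (by `Iff.rfl`). -/
theorem allowed_iff (i : Fin 2) (χ : (T.t12 V c).X) :
    M.toBallSpanModel.allowed i χ ↔ (T.t12 V c).allowed χ := Iff.rfl

/-- **Seam S2, by name**: in a good context, `T.Open_chars` (node N31 = Lemma 4.2(b) typed; side-(12) half) makes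
every datum of the constructed model allowed. -/
theorem allowed_of_openChars (hch : T.Open_chars) (hc : T.GoodCtx ι₁ c) (i : Fin 2) (χ : (T.t12 V c).X) :
    M.toBallSpanModel.allowed i χ :=
  (hch V c hc).1 χ

/-- The same from pv13's cluster outputs (`open_chars_of_cluster`, run 19). -/
theorem allowed_of_cluster (h31 : ClusterOutputs T) (hc : T.GoodCtx ι₁ c) (i : Fin 2) (χ : (T.t12 V c).X) :
    M.toBallSpanModel.allowed i χ :=
  M.allowed_of_openChars (open_chars_of_cluster T h31) hc i χ

/-- **The per-context residual of node N33 on the pv03 ball route, WITHOUT the allowedness clause**: pv02's five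
group-level INPUT Props (`BallSpanModel.GroupInputs`: N09–N10, N33b, N30 + N33a), the definitional sentence
`HolFromBall` (D2/D6), `Δ` dense (PRINT: real approximation), and the three dictionary Props `Dict_thetaClass₀/₁`
(DEFINITIONAL D2), `Dict_cupWedge` (PRINT Voisin) of `WedgeToClasses`. -/
def Inputs : Prop :=
  M.toBallSpanModel.GroupInputs ∧ M.toBallSpanModel.toLineSpans.HolFromBall ∧
    Dense (M.toBallSpanModel.toBallFormsModel.Δ : Set U21) ∧
    M.toBallSpanModel.toBallFormsModel.toFormsModelT.Dict_thetaClass₀ T c ∧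
    M.toBallSpanModel.toBallFormsModel.toFormsModelT.Dict_thetaClass₁ T c ∧
    M.toBallSpanModel.toBallFormsModel.toFormsModelT.toFormsModel.Dict_cupWedge

/-- Ball-level N33c (all three conjuncts of `WedgeNonvanishing.N33c_statement`, incl. `StableUnder`) for the
constructed model — pv03 `BallSpanModel.n33c` ∘ pv02 `LineSpanData.N33c_of`, restated for the record. -/
theorem n33c (h : M.Inputs) :
    N33c_statement M.toBallSpanModel.toBallFormsModel.Δ A M.toBallSpanModel.toBallFormsModel.gen₁
      M.toBallSpanModel.toBallFormsModel.gen₂ :=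
  M.toBallSpanModel.n33c h.1 h.2.1

end CharLineSpans

/-- **`CharSpanStepsInput T`**: per good context, a `CharLineSpans T V c` with `CharLineSpans.Inputs` — pv03's
`BallSpanStepsInput T` MINUS the clause `∀ i χ, M.allowed i χ`. -/
def CharSpanStepsInput : Prop :=
  ∀ {L : CMField} {ι₁ : L →+* ℂ} (V : HermSpace3 L ι₁) (c : SeesawCtx L), T.GoodCtx ι₁ c →
    ∃ M : CharLineSpans T V c, M.Inputs

/-- **Seam S2 closed by name**: `CharSpanStepsInput T` and `T.Open_chars` (node N31) give pv03's
`BallSpanStepsInput T`. -/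
theorem ballSpanStepsInput_of_chars (hch : T.Open_chars) (h : CharSpanStepsInput T) : BallSpanStepsInput T := by
  intro L ι₁ V c hc
  obtain ⟨M, hG, hH, hΔ, h₀, h₁, hcup⟩ := h V c hc
  exact ⟨M.toBallSpanModel, hG, hH, hΔ, M.allowed_of_openChars hch hc, h₀, h₁, hcup⟩

/-- **A6 `Open_thetaWedge` (node N33) on the pv03 ball route with allowedness fed by node N31**: from `LevelDirected`
(KERNEL), `N33eClosed` (pv01, KERNEL), `T.Open_chars` (N31) and `CharSpanStepsInput T`. -/
theorem open_thetaWedge_of_charSpans (hLD : LevelDirected) (hE : N33eClosed) (hch : T.Open_chars)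
    (h : CharSpanStepsInput T) : T.Open_thetaWedge :=
  open_thetaWedge_of_ballSpans T hLD hE (ballSpanStepsInput_of_chars T hch h)

/-- The same with N31 supplied by pv13's cluster outputs (`open_chars_of_cluster`) and `LevelDirected` discharged
in-package (`HodgeCM.levelDirected`). -/
theorem open_thetaWedge_of_cluster (hE : N33eClosed) (h31 : ClusterOutputs T) (h : CharSpanStepsInput T) :
    T.Open_thetaWedge :=
  open_thetaWedge_of_charSpans T HodgeCM.levelDirected hE (open_chars_of_cluster T h31) h

/-- **N34 from the DAG nodes with ONE leaf for N31 and N33's allowedness**: the carver's `perL_of_nodes_HM` with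
`h31 : ClusterOutputs T` feeding BOTH `N31_chars T` (pv13 `N31_of_cluster`) and, through `open_thetaWedge_of_cluster`,
`N33_wedge T`; the remaining N33 input is `N33eClosed` (KERNEL, pv01) + `CharSpanStepsInput T`. -/
theorem perL_of_nodes_charSpans (MA : U.ModelAxioms)
    (h07 : N07_hodgeRiemann20 U) (h09a : N09a_embCover T) (h09b : N09b_innerEmb T)
    (h12a : N12a_thetaSub T) (h12b : N12b_signRecipe T) (hHM : HasseMinkowskiQuinary)
    (h19w : N19w_wedgeMem T) (h19g : N19g_genInWedgeSpan T) (h29 : N29_occ T) (h31 : ClusterOutputs T)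
    (hE : N33eClosed) (h33 : CharSpanStepsInput T) : U.PerL :=
  perL_of_nodes_HM MA T h07 h09a h09b h12a h12b hHM h19w h19g h29 (N31_of_cluster T h31)
    ((N33_iff T).mpr (open_thetaWedge_of_cluster T hE h31 h33))

end CharSpans
end PerL34
end HodgeCM

end
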